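import Literature.Claims.NS.ClayR3L3Bridge
import Literature.Analysis.FluidPDE.SuitableWeak
import HarnessLib

/-!
# CLAIM C168 — J. T. Cox, «Resolving Global Regularity for the 3D Navier–Stokes Equations at the
# Critical Endpoint: A Minimal-Element Rigidity Argument» (Zenodo 17503936, v2 «Submit.8», 2025-11-01, 124 pp.)

Cell `ns-claims` (D-0090), claim **C168** (RULINGS v1.43, lead-1 g7, 2026-08-27T14:57:10Z; tail tranche 4f,
census §B), typist of record `ns-claims-typist-5 g7`. TEXT OF RECORD: Zenodo record 17503936 (concept
17489259, v2 of 2), PDF «Navier-StokesFINAL.Submit.8.pdf» sha256[:16] `2301be9c1f617287`, 124 pp., PDF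
page = printed page = `pages/pNNN.txt` of `run/shared/lean/pub/ns-claims/sources/Cox2025/` (LOCATORS v2,
ns-claims-lit-2; census pin `census/texts/Cox2025/`); bib `Cox2025`; «p.N l.M» = line M of `pNNN.txt`.
UNREFEREED CLAIM under adjudication — NOTHING in this file asserts a step of the paper: the claimed
statements and the printed steps are `def … : Prop`; the `theorem`s of §E are pure logic plus tree
theorems (the blow-up alternative `ClayVariants.clayR3_solvable_or_supBlowup`, the
Escauriaza–Seregin–Šverák continuation `IsClassicalNSSolutionOn.exists_Icc_of_eLpNorm_three_bounded`, the
Clay-(A) doors `clayR3_regularityAt_iff`, `biSup_eLpNorm_three_lt_top_of_clayR3_solvable`). CARD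
`claims/Cox2025/CARD.md` (PREDICTION sealed 2026-08-27T15:00Z, sha16 `66ebb78e35946cba`, written from
RULINGS v1.43 + pp. 1, 6, 9 only). Verdict vocabulary is the refuter's / referee's.

## Setting (p.5 l.2–5)
«Standing Clay (A) setting. We normalize ν = 1 by scaling and work in the unforced case f ≡ 0 on ℝ³. All
statements below are in this setting.» Typed at `ν = 1`; (A) at one viscosity ⇔ (A) (tree
`clayR3_regularityAt_iff`).

## The claimed statement, as printed
* **Theorem 1.1 p.6 l.1–28**: «Let u0 : ℝ³ → ℝ³ be smooth and divergence-free (e.g. u0 ∈ 𝒮(ℝ³)). Then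
  the three-dimensional incompressible Navier–Stokes equations on ℝ³ admit a unique, global solution
  (u, p) with (u, p) ∈ C^∞(ℝ³ × [0, ∞)), u ∈ L^∞([0, ∞); L³(ℝ³)), p = R_iR_j(u_iu_j), (1.1) with
  quantitative bounds depending only on ‖u0‖_{L²} and ‖u0‖_{L³} …». Cor 1.4 p.6 l.59–61 «the smoothness
  clause (6) in the Clay statement holds»; Cor 1.3 / Cor 9.4 (energy equality) supply (7).
* **Theorem 9.6 p.44 l.26–37** (the 𝒮-grain face): «For every smooth divergence-free u0 ∈ 𝒮(ℝ³), the
  solution remains smooth on (0,∞)×ℝ³. … Mechanism. The minimal-element contradiction (Sec. 4)—built on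
  APMS extraction (KL–1), pressure-smart LEI (KL–2), dyadic Carleman (KL–3), reverse Hölder gain (KL–4),
  and Liouville rigidity (KL–5)—precludes finite-time blow-up. KL–6/7 close the Type I/II channels.»
`ClaimedTheorem` := Thm 9.6 at the 𝒮 = (4) grain as Clay-solvability at ν = 1 of every datum;
`ClaimedTheorem11` := Thm 1.1's extra clauses (uniqueness, u ∈ L^∞_t L³_x) on the same data; Thm 1.1's
wider data («smooth and divergence-free», Rem 1.2 «L² ∩ L³ via density») and «p = R_iR_j(u_iu_j)» are
recorded (`-- TODO(general form)`), not typed.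

## Clay delta (reference `ClayVariants.lean`; nearest = (A) `clayR3.Regularity`)
Δ1 ℝ³ (=) · Δ2 NS, ν normalised to 1 (= by `clayR3_regularityAt_iff`) · Δ3 f ≡ 0 (=) · Δ4 data 𝒮 = (4) at
Thm 9.6 (=); Thm 1.1 / Rem 1.2 WIDER (recorded) · Δ5 conclusion (6) ✓, (7) via the energy identity ✓,
EXTRA clauses uniqueness / L^∞_t L³_x / Riesz pressure (face `ClaimedTheorem11`) · Δ6 uniqueness extra ·
Δ7 one ν ⇔ all ν. **`claimedTheorem_iff_clayA : ClaimedTheorem ↔ clayR3.Regularity` PROVED** — no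
«wrong problem» axis; the claim COVERS (A).

## The printed chain (dependency order = binder order of `claim_of_steps`) and how it is typed
1. `Step_local` — p.7 l.1–6 «By classical local theory … there exists t0 > 0 with (u, p) ∈ C^∞(ℝ³ ×
   [0, t0]). Our global a priori estimates (KL–1 through KL–7) rule out singularity formation» with the
   §4 opening p.19 l.15–16 «assume that a smooth solution develops a singularity at a finite time T∗ > 0»:
   every datum is Clay-solvable at ν = 1 OR carries a SINGULAR solution (`IsSingular`: the finite-energy
   classical solution on `[0,T*)`, `T* > 0`, with no finite-energy classical solution from the datum on
   the closed slab `[0,T*]`). TRUE — PROVED (`step_local_holds`, the tree's blow-up alternative).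
2. **`Step_setup` — §4 «Setup for the KL chain» p.19 l.15–31 with (4.1) «δ := M_c − lim sup_n sup_t
   ‖u^n(t)‖_{L³} > 0», Lemma 1.12 p.8 l.59–66, KL-1's «sup_{t≤0}‖u∞(t)‖_{L³} ≤ M_c < ∞» p.20 l.4–6, and
   Thm G.5 proof (i) p.107 l.37–45 «Minimal blow-up threshold. Suppose (G.29) fails. Define M∗ := inf{M >
   0 : ∃ u suitable with sup_{t<T(u)} ‖u(t)‖_{L³} > M}. (G.30) Pick a sequence u^n with sup_{t<T_n}
   ‖u^n(t)‖_{L³} ↓ M∗ and T_n < ∞»**: IF a singularity occurs THEN the minimal critical level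
   `critLevel` (= M_c = M∗, typed as the infimum over singular solutions of `sup_{t<T*} ‖u(t)‖_{L³}`, in
   `ℝ≥0∞`, empty class ⇒ `⊤` — junk-free) is FINITE and a minimising sequence of singular solutions with
   finite critical levels exists (`MinimisingData`). This is the passage the Kenig–Merle extraction needs
   (App. F.4 runs under (F.22) «‖u‖_{L^∞_t L³_x((−∞,T∗))} ≤ M < ∞», p.96 l.29–32). KERNEL FACTS (§E, tree
   ESS door): `L3sup_eq_top_of_singular` (every singular solution from a datum of class (4) has
   `sup_{t<T*}‖u(t)‖_{L³} = ∞`), hence `critLevel_eq_top`, `not_minimisingData`, and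
   **`step_setup_iff_claimedTheorem : Step_setup ↔ ClaimedTheorem`** (ROUTE 5b face: the set-up step is
   equivalent to the claimed theorem).
3. `Step_KL1` — Prop 4.1 p.19 l.32 – p.20 l.16 at the grain of its proof (App. F.4, Def F.7 / Prop F.8
   p.96 l.28 – p.98 l.70; Thm G.5 (ii) p.107 l.46–53): from the minimising data, a NONTRIVIAL ancient
   suitable APMS profile `(u∞, p∞)` on `(−∞,0] × ℝ³` with `sup_{t≤0}‖u∞(t)‖_{L³} ≤ M_c`. As typed its
   input is uninhabited (`not_minimisingData`), so `step_KL1_holds` (vacuously TRUE — recorded, not a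
   claim about App. F). The bare printed sentence (no hypothesis, «≤ M_c < ∞») is the recorded face
   `Step_KL1_bare`; the hypothesis-carrying face `Step_KL1_hyp` («a singularity ⇒ such a profile with
   M_c < ∞») satisfies `step_KL1_hyp_iff_claimedTheorem`.
4. `Step_KL2` — Prop 4.2 p.20 l.17–49 at statement grain: the local Calderón–Zygmund pressure split on
   parabolic cylinders for suitable pairs (p = p_loc + p_far, ‖p_loc‖_{L^{3/2}(Q)} ≤ C_CZ‖u‖²_{L³(Q)},
   p_far(·,t) harmonic on the ball); the corrector / tail-budget clauses (4.2) Σ τ_m ≤ τ0 and (4.3) over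
   the undisplayed `τ_m`, `h_Q`, `W^{−1/3,3/2}(∂A)` are RECORDED, not typed.
5. `Step_KL3 K` — Prop 4.3 (4.4)–(4.5) p.20 l.50 – p.21 l.33, the dyadic Carleman inequality, typed
   VERBATIM over the paper's undisplayed gadgets (`CarlemanKit K`: Littlewood–Paley blocks Δ_j, weights
   ω_{j,τ}, the «absorbed» functionals A_j[u], P_j[u,p], the constant and τ0) — posits as named data
   (RULINGS 11:21Z (1)), the display as the Step.
6. `Step_KL4` — Prop 4.4 p.21 l.34–45: APMS profiles are in `L^{3+ε}_loc((−∞,0] × ℝ³)`.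
7. `Step_KL5_of K` — Thm 4.5 second sentence p.21 l.48–49 («(KL-3) and (KL-4) yield backward uniqueness
   at the endpoint, eliminating nontrivial ancient solutions with APMS compactness»; App. E Prop E.9 p.89
   l.9–16): KL-2 ∧ KL-3 ∧ KL-4 ⇒ `Step_KL5` (Thm 4.5 first sentence / Prop E.9: every ancient suitable
   APMS profile with `sup_t‖u∞‖_{L³} < ∞` vanishes). Records: Prop E.9's proof applies Thm E.8 (backward
   uniqueness from `u(·,0) ≡ 0`) and continues «Since u∞(·, 0) is arbitrary, we deduce u∞ ≡ 0» (p.89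
   l.14–16) — the hypothesis `u∞(·,0) ≡ 0` is not supplied there; behind the set-up step, recorded only.
8. `Step_KL6` — Prop 4.6 first sentence p.22 l.3–9 (= Thm 1.11 p.8 l.50–58 = Props 5.6 / 6.4 / 8.2 / 9.3):
   universal ε⋆ > 0, θ, ρ ∈ (0,1) with «either E3(z0, r0) ≤ ε⋆, or E3(z0, θr0) ≤ ρ E3(z0, r0)» for
   every cylinder of every suitable solution. No display defining `E3` was found in the text layer of
   pp. 1–124 (grep); typed as the CKN scale-invariant cubic quantity `cknC r z u = r⁻² ∫∫_{Q_r(z)} |u|³`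
   (the «scale-invariant L³-type quantity» of the Type-I / ε-regularity register, Thm 1.11 «then standard
   smoothing») — recorded; a located definition would replace `cknC` in `Step_KL6` only.
9. `Step_KL6_closes K` — Prop 4.6 second sentence p.22 l.10–11 («Combined with KL-3 coercivity and the
   pressure-smart LEI (KL-2), this contradicts minimality of M_c; hence no Type I blow-up can occur»).
10. `Step_KL7_closes K` — Cor 4.7 p.22 l.14–17 («If blow-up were Type II, the KL-4 reverse Hölder gain
   feeds into KL-3, yielding the same contradiction as in KL-6. Thus no blow-up of any type occurs»).
11. `Step_Thm72 S` — Thm 7.2 (7.8) p.35 l.9–14 over posited shell/slab functionals (`ShellKit S`: tails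
   T_J, boundary budgets B_J, peak index J∗) — statement grain by pointer (App. D); consumed in print only
   inside App. F (F.32) and the KL-6 proofs; NOT a binder of the compositions (recorded).
12. `Step_G5` — Thm G.5 (G.29) p.107 l.23–36 «For any divergence-free u0 ∈ L³(ℝ³), the suitable
   solution satisfies sup_{t≥0}‖u(t)‖_{L³(ℝ³)} ≤ M(‖u0‖_{L³}). Orientation: This precludes finite-time
   blow-up», INSTANTIATED on finite-energy classical solutions from 𝒮 data on half-open slabs (the
   print's class «the suitable solution» from L³ data is wider — TODO(general form)); its printed proof
   (i)–(iv) IS the §4 chain, step (i) = `Step_setup`. `claim_of_G5 : Step_G5 → ClaimedTheorem` PROVED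
   (the tree's a-priori-L³ door).

COMPOSITION — PROVED, every binder consumed: `claim_of_steps K : Step_local → Step_setup → Step_KL1 →
Step_KL2 → Step_KL3 K → Step_KL4 → Step_KL5_of K → ClaimedTheorem` (route R1, Thm 9.6 «Mechanism»: a
singular solution ⇒ minimising data ⇒ nontrivial APMS profile ⇒ (KL-5) the profile vanishes —
contradiction); `claim_of_steps_typeI_II K : Step_local → Step_KL2 → Step_KL3 K → Step_KL4 → Step_KL6 →
Step_KL6_closes K → Step_KL7_closes K → ClaimedTheorem` (route R2, «KL–6/7 close the Type I/II
channels»). Discharged in-file: `step_local_holds`, `step_KL1_holds` (vacuous); circular faces: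
`step_setup_iff_claimedTheorem`, `step_KL1_hyp_iff_claimedTheorem`. Rev 2 (append-only §F + one in-place
artefact fix): `Step_KL6_mass` (the raw-mass reading of the undefined `E3`, Prop B.11 (B.35) p.62),
`cylL3`, `cknC_eq_cylL3`; the modulus-carrying profile class `IsAPMSProfileMod` (Def 2.3 (2.7) over posits,
`HasModulus`) with faces `Step_KL4_mod` / `Step_KL5_mod` implied by `Step_KL4` / `Step_KL5` (2-READ (5a));
`ClaimedTheorem11`'s uniqueness clause restricted to `t ≥ 0` (values at `t < 0` are not part of a solution on
the closed half-space). Not typed (records): Table 1 / (1.2)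
calibration, Props 1.6–1.10, (S1)–(S5), §§5–8 restatements, App. H. The print's solution class for M_c /
(G.29) is «suitable» (wider than the finite-energy classical solutions from 𝒮 data used here — the class on
which the tree's ESS continuation theorem lives); on the wider class the text's own reference [11]
(Escauriaza–Seregin–Šverák, p.5 l.20, p.19 l.11–12) gives the same `M_c = +∞`. `-- TODO(general form)`.

WHAT THIS IS NOT: not a claim about NS regularity or blow-up; not a claim about any author beyond the
typed locator.
-/

open scoped ContDiff ENNReal NNReal Topology Laplacian
open _root_.MeasureTheory _root_.Set _root_.Filter Function

noncomputable section

namespace Literature.Claims.NS.Cox2025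

open Literature.Analysis Literature.Analysis.FluidPDE Literature.Claims.NS.ClayVariants

/-! ## A. Vocabulary (the print's setting: ℝ³, ν = 1, f ≡ 0 — p.5 l.2–5) -/

/-- Euclidean `ℝ³`. [folklore] -/
abbrev E3 : Type := EuclideanSpace ℝ (Fin 3)

/-- **The data of Theorem 9.6** (p.44 l.26–28 «smooth divergence-free u0 ∈ 𝒮(ℝ³)»): C^∞, divergence
free, every derivative rapidly decaying — Fefferman's class (4). Thm 1.1 p.6 l.1–5 prints the WIDER
«smooth and divergence-free (e.g. u0 ∈ 𝒮(ℝ³))» and Rem 1.2 p.6 l.29–43 extends to `L² ∩ L³` «via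
density» (recorded). `-- TODO(general form): the no-decay and L² ∩ L³ data classes.`
[cite: Cox2025, Thm 9.6 p.44 l.26–28; Thm 1.1 p.6 l.1–5] [cite: FeffermanClay2006, (4) p.1] -/
def IsDatum (u₀ : E3 → E3) : Prop :=
  ContDiff ℝ ∞ u₀ ∧ NSWave0.IsDivFree u₀ ∧ HasRapidSpatialDecay u₀

/-- Energy bounded on a set of times: `∃ A < ∞, ∀ t ∈ s, ∫ |u(t)|² ≤ A` (Fefferman's (7) on `s`).
[cite: FeffermanClay2006, (7) p.2] -/
def FiniteEnergyOn (s : Set ℝ) (u : ℝ → E3 → E3) : Prop :=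
  ∃ A : ℝ≥0∞, A < ⊤ ∧ ∀ t ∈ s, ∫⁻ x, ‖u t x‖ₑ ^ 2 ≤ A

/-- The critical level of a solution on `[0,T)`: `sup_{0 ≤ t < T} ‖u(t)‖_{L³(ℝ³)}` (extended real; the
print's «sup_{t<T(u)} ‖u(t)‖_{L³}», (G.30) p.107, (F.22)–(F.23) p.96, «L^∞_t L³_x» p.1 l.11–16).
[cite: Cox2025, (G.30) p.107 l.38–40; (F.22) p.96 l.31–32] -/
def L3sup (T : ℝ) (u : ℝ → E3 → E3) : ℝ≥0∞ := ⨆ t ∈ Ico 0 T, eLpNorm (u t) 3 volume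

/-- **«a smooth solution develops a singularity at a finite time T∗ > 0»** (§4 p.19 l.15–16; Cor 1.4's
justification p.7 l.1–6 «there exists t0 > 0 with (u, p) ∈ C^∞(ℝ³ × [0, t0]). Our global a priori
estimates … rule out singularity formation and propagate smoothness to all t ≥ 0»): `(u, p)` is a
classical solution of the unforced system at `ν = 1` on the half-open slab `[0,T) × ℝ³`, `T > 0`, with
`u(0) = u₀` and energy bounded on `[0,T)`, and NO finite-energy classical solution from `u₀` exists on
the CLOSED slab `[0,T]` (T is the maximal time of smooth finite-energy existence — Leray's reading; by
the tree's dichotomy such a solution has `sup |u| = ∞` on `[0,T) × ℝ³`).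
[cite: Cox2025, §4 p.19 l.15–16; p.7 l.1–6] [cite: Leray1934, §33] -/
def IsSingular (u₀ : E3 → E3) (T : ℝ) (u : ℝ → E3 → E3) (p : ℝ → E3 → ℝ) : Prop :=
  0 < T ∧ IsClassicalNSSolutionOn (Ico 0 T) 1 0 u p ∧ u 0 = u₀ ∧ FiniteEnergyOn (Ico 0 T) u ∧
    ∀ (w : ℝ → E3 → E3) (q : ℝ → E3 → ℝ),
      IsClassicalNSSolutionOn (Icc 0 T) 1 0 w q → w 0 = u₀ → ¬ FiniteEnergyOn (Icc 0 T) w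

/-- «no finite-time blow-up» for the data of Thm 9.6: no datum of class (4) carries a singular solution.
[cite: Cox2025, Thm 9.6 p.44 l.33–35 «precludes finite-time blow-up»; p.9 l.46–47] -/
def NoSingular : Prop :=
  ¬ ∃ (u₀ : E3 → E3) (T : ℝ) (u : ℝ → E3 → E3) (p : ℝ → E3 → ℝ), IsDatum u₀ ∧ IsSingular u₀ T u p

/-- **M_c — the minimal blow-up threshold** ((4.1) p.19 l.21–27 / Lemma 1.12 p.8 l.59–62 «δ := M_c −
lim sup_n sup_t ‖u^n(t)‖_{L³} > 0»; Prop 4.1 p.20 l.4–6 «sup_{t≤0}‖u∞(t)‖_{L³} ≤ M_c < ∞»; (G.30) p.107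
l.38–40 «M∗ := inf{M > 0 : ∃ u suitable with sup_{t<T(u)} ‖u(t)‖_{L³} > M}» with l.41–45 «Pick a
sequence u^n with sup_{t<T_n}‖u^n(t)‖_{L³} ↓ M∗ and T_n < ∞»): the infimum, over singular solutions from
data of class (4), of their critical levels `sup_{t<T∗}‖u(t)‖_{L³}` — in `ℝ≥0∞`, so that an EMPTY class
(or a class all of whose levels are infinite) gives `⊤` and «M_c < ∞» is then FALSE, not junk. (The
literal set of (G.30), `{M > 0 : ∃ u, sup_t‖u(t)‖_{L³} > M}`, is all of `(0,∞)` as soon as large data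
exist — its infimum is 0; the typed reading is the one l.41–45 and KL-1 use: the minimal critical level
among blow-up solutions. Recorded.) Typed on the singular solutions from data of class (4) (the print's
«u suitable» is wider; a wider class can only LOWER the infimum, and the text's own reference [11] = ESS
gives `+∞` there as well — `-- TODO(general form)`).
[cite: Cox2025, (4.1) p.19 l.21–27; Prop 4.1 p.20 l.4–6; (G.30) p.107 l.37–45] -/
def critLevel : ℝ≥0∞ :=
  ⨅ (u₀ : E3 → E3) (T : ℝ) (u : ℝ → E3 → E3) (p : ℝ → E3 → ℝ) (_ : IsDatum u₀ ∧ IsSingular u₀ T u p),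
    L3sup T u

/-- **The minimising data of the Kenig–Merle set-up** (Thm G.5 proof (i) p.107 l.37–45 «Pick a sequence
u^n with sup_{t<T_n} ‖u^n(t)‖_{L³} ↓ M∗ and T_n < ∞»; Def F.7 (F.22)–(F.23) p.96 l.29–45 «Let (u, p) be
suitable on (−∞, T∗) × ℝ³ with ‖u‖_{L^∞_t L³_x((−∞,T∗))} ≤ M < ∞ … Pick t_n ↑ T∗»; (4.1) p.19): the
minimal threshold is finite and is the limit of the (finite) critical levels of a sequence of singular
solutions. [cite: Cox2025, Thm G.5 proof (i) p.107 l.37–45; Def F.7 p.96 l.29–45; (4.1) p.19 l.20–31] -/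
def MinimisingData : Prop :=
  critLevel < ⊤ ∧
    ∃ (U₀ : ℕ → E3 → E3) (Tn : ℕ → ℝ) (Un : ℕ → ℝ → E3 → E3) (Pn : ℕ → ℝ → E3 → ℝ),
      (∀ n, IsDatum (U₀ n) ∧ IsSingular (U₀ n) (Tn n) (Un n) (Pn n) ∧ L3sup (Tn n) (Un n) < ⊤) ∧
      Tendsto (fun n => L3sup (Tn n) (Un n)) atTop (𝓝 critLevel)

/-! ### Ancient suitable solutions and APMS (Def 2.1, (2.5)–(2.7), p.10–11; Prop 4.1 p.20) -/

/-- The open ancient region `(−∞, 0) × ℝ³` (in the tree's `(t, x)` order). [cite: Cox2025, Prop 4.1 p.20 l.1] -/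
def ancientRegion : TopologicalSpace.Opens (ℝ × E3) :=
  ⟨Iio 0 ×ˢ univ, isOpen_Iio.prod isOpen_univ⟩

/-- **Ancient suitable solution on `(−∞, 0] × ℝ³`** (Prop 4.1 p.20 l.1; Def 2.1 p.10 l.31–70 = the
Caffarelli–Kohn–Nirenberg suitable class: `u ∈ L^∞_t L²_x ∩ L²_t Ḣ¹_x` locally, `p ∈ L^{3/2}_loc`,
(2.1) distributionally, the local energy inequality (2.3)) — the tree's `IsSuitableWeakSolutionOn` at
`ν = 1`, `f ≡ 0`, on the open region `(−∞,0) × ℝ³` (the slice `t = 0` enters through the `L³` bounds).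
[cite: Cox2025, Def 2.1 p.10 l.31–70; Prop 4.1 p.20 l.1] [cite: CaffarelliKohnNirenberg1982, §2 (2.1)–(2.5)] -/
def IsAncientSuitable (U : ℝ → E3 → E3) (P : ℝ → E3 → ℝ) : Prop :=
  IsSuitableWeakSolutionOn ancientRegion 1 0 U P

/-- `sup_{t ≤ 0} ‖U(t)‖_{L³(ℝ³)}` (extended real). [cite: Cox2025, Prop 4.1 p.20 l.4–6] -/
def L3supAncient (U : ℝ → E3 → E3) : ℝ≥0∞ := ⨆ t ∈ Iic (0 : ℝ), eLpNorm (U t) 3 volume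

/-- The critical modulation `x ↦ λ · v(c + λ x)` of a slice (Prop 4.1 p.20 l.7 «modulo translations x ↦
x − x∞(t) and critical scaling u ↦ λ∞(t)u(λ∞(t)·, ·)»; `L³`-invariant). (2.6) p.11 prints
«λ(t)^{−1} u(x(t) + λ(t)x, t)» — with the critical scaling of l.7 the prefactor is `λ`, recorded.
[cite: Cox2025, Prop 4.1 p.20 l.7; (2.6) p.11 l.33–43] -/
def modulate (lam : ℝ) (c : E3) (v : E3 → E3) : E3 → E3 := fun x => lam • v (c + lam • x)

/-- **APMS — «almost periodic modulo symmetries»** ((2.6) p.11 l.33–48 «The modulated orbit O[u] := {…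
: t ∈ I} ⊂ L³(ℝ³). We say u is almost periodic modulo symmetries (APMS) on I if O[u] is precompact in
L³»; Prop 4.1 p.20 l.7–12): there are modulation parameters `λ(t) > 0`, `x(t)` such that the modulated
slices `{λ(t) U(x(t) + λ(t)·, t) : t ≤ 0}` form a TOTALLY BOUNDED family for the `L³` distance (=
precompact in `L³`): for every `ε > 0` finitely many `L³` fields `ε`-approximate every member. The
print's canonical choice of `(λ(t), x(t))` by peak Littlewood–Paley index and barycentre ((2.5), Def F.9)
and the quantitative modulus `ϑ_APMS` of Def 2.3 (2.7) (a frequency-tail condition over homogeneous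
Littlewood–Paley blocks) are not typed — `ϑ_APMS` enters the typed chain only as a named number in the
constants of KL-4 / KL-6 (recorded). [cite: Cox2025, (2.5)–(2.7) p.11 l.22–55; Prop 4.1 p.20 l.7–12] -/
def IsAPMS (U : ℝ → E3 → E3) : Prop :=
  ∃ (lam : ℝ → ℝ) (xc : ℝ → E3), (∀ t : ℝ, t ≤ 0 → 0 < lam t) ∧
    ∀ ε : ℝ, 0 < ε → ∃ F : Finset (E3 → E3), (∀ g ∈ F, MemLp g 3 volume) ∧
      ∀ t : ℝ, t ≤ 0 → ∃ g ∈ F, eLpNorm (modulate (lam t) (xc t) (U t) - g) 3 volume < ENNReal.ofReal ε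

/-- **The ancient APMS profiles of KL-1 / KL-4 / KL-5** (Prop 4.1 p.20 l.1–12; Prop E.9 p.89 l.9–11 «an
ancient suitable solution which is APMS with modulus ϑ_APMS < 1 and ‖u∞‖_{L^∞_t L³_x} < ∞»): ancient
suitable, `L³`-bounded on `(−∞,0]`, APMS. [cite: Cox2025, Prop 4.1 p.20 l.1–12; Prop E.9 p.89 l.9–11] -/
structure IsAPMSProfile (U : ℝ → E3 → E3) (P : ℝ → E3 → ℝ) : Prop where
  /-- `(u∞, p∞)` is an ancient suitable solution on `(−∞,0) × ℝ³`. -/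
  suitable : IsAncientSuitable U P
  /-- `sup_{t≤0} ‖u∞(t)‖_{L³} < ∞`. -/
  l3bound : L3supAncient U < ⊤
  /-- the modulated orbit is precompact in `L³`. -/
  apms : IsAPMS U

/-- «nontrivial» (Prop 4.1 p.19 l.32–33, p.20 l.1): not a.e. zero at every time `t ≤ 0`.
[cite: Cox2025, Prop 4.1 p.19 l.32 – p.20 l.1] -/
def IsNontrivial (U : ℝ → E3 → E3) : Prop := ¬ ∀ t : ℝ, t ≤ 0 → U t =ᵐ[volume] 0

/-! ## B. The claimed statements (nothing asserted) -/

/-- **CLAIMED THEOREM = Theorem 9.6 p.44 l.26–29 at the print's ν = 1** («For every smooth divergence-free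
u0 ∈ 𝒮(ℝ³), the solution remains smooth on (0,∞)×ℝ³») read with Cor 1.4 p.6 l.59–61 («(u, p) ∈ C^∞(ℝ³ ×
[0, ∞)) … the smoothness clause (6) in the Clay statement holds») and the energy identity Cor 1.3 / Cor 9.4
((7)): every datum of class (4) is Clay-solvable at viscosity 1 (`clayR3.Solvable 1 0 u₀`: smooth `u, p` on
`ℝ³ × [0,∞)` solving (1)–(3) with bounded energy). [claim: Cox2025, status: disputed]
[cite: Cox2025, Thm 9.6 p.44 l.26–29; Cor 1.4 p.6 l.59–61; p.5 l.2–5] [cite: FeffermanClay2006, (A) with (4) (6) (7) p.2] -/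
def ClaimedTheorem : Prop :=
  ∀ u₀ : E3 → E3, IsDatum u₀ → clayR3.Solvable 1 0 u₀

/-- **Theorem 1.1 p.6 l.1–28, extra clauses, on the data of Thm 9.6** («admit a unique, global solution
(u, p) with (u, p) ∈ C^∞(ℝ³ × [0, ∞)), u ∈ L^∞([0, ∞); L³(ℝ³))»): a Clay-sense solution at ν = 1 which is
bounded in `L³` uniformly in `t ≥ 0` and is the ONLY Clay-sense solution from `u₀` (uniqueness among
smooth bounded-energy solutions on `ℝ³ × [0,∞)`: they agree at every `t ≥ 0` — the fields' values at
`t < 0` are not part of a solution on the closed half-space; rev 2 restricts the equality to `t ≥ 0`). Not typed: «p = R_iR_j(u_iu_j)» (the momentum equation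
fixes `∇p` only; recorded), the «quantitative bounds depending only on ‖u0‖_{L²} and ‖u0‖_{L³}» (face
`Step_G5`), Cor 1.3 / 9.4 / 9.5 for Leray–Hopf solutions. [claim: Cox2025, status: disputed]
[cite: Cox2025, Thm 1.1 p.6 l.1–28] -/
def ClaimedTheorem11 : Prop :=
  ∀ u₀ : E3 → E3, IsDatum u₀ →
    ∃ (u : ℝ → E3 → E3) (p : ℝ → E3 → ℝ),
      IsSmoothOnHalfSpace u ∧ IsSmoothOnHalfSpace p ∧ IsNavierStokesSolution 1 0 u₀ u p ∧
        HasBoundedEnergy u ∧ (⨆ t ∈ Ici (0 : ℝ), eLpNorm (u t) 3 volume) < ⊤ ∧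
        ∀ (u' : ℝ → E3 → E3) (p' : ℝ → E3 → ℝ),
          IsSmoothOnHalfSpace u' → IsSmoothOnHalfSpace p' → IsNavierStokesSolution 1 0 u₀ u' p' →
            HasBoundedEnergy u' → ∀ t : ℝ, 0 ≤ t → u' t = u t

/-! ## C. The printed steps (nothing asserted) -/

/-- **Step 0 — local theory and the singularity alternative** (p.7 l.1–6 «By classical local theory for
smooth divergence-free data on ℝ³ (Picard iteration with parabolic regularity), there exists t0 > 0 with
(u, p) ∈ C^∞(ℝ³ × [0, t0]). Our global a priori estimates (KL–1 through KL–7) rule out singularity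
formation and propagate smoothness to all t ≥ 0»; §4 p.19 l.15–16 «To derive a contradiction, assume that
a smooth solution develops a singularity at a finite time T∗ > 0»): every datum of class (4) is
Clay-solvable at ν = 1 or carries a singular solution. TRUE — PROVED below (`step_local_holds`).
[claim: Cox2025, status: disputed] [cite: Cox2025, p.7 l.1–6; §4 p.19 l.15–16] -/
def Step_local : Prop :=
  ∀ u₀ : E3 → E3, IsDatum u₀ →
    clayR3.Solvable 1 0 u₀ ∨ ∃ (T : ℝ) (u : ℝ → E3 → E3) (p : ℝ → E3 → ℝ), IsSingular u₀ T u p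

/-- **Step 1 — THE SET-UP OF THE KENIG–MERLE CHAIN** (§4 «Setup for the KL chain» p.19 l.15–31: «assume
that a smooth solution develops a singularity at a finite time T∗ > 0. After rescaling so that T∗ = 0 and
applying the canonical normalization from Section 2, we isolate a minimal ancient profile precompact
modulo symmetries (KL-1). … Notably, the compactness modulus satisfies ϑ_APMS ≤ 1 − c⋆ δ, δ := M_c − lim
sup_n sup_t ‖u^n(t)‖_{L³} > 0 … (4.1)»; KL-1 p.20 l.4–6 «≤ M_c < ∞»; Thm G.5 proof (i) p.107 l.37–45
«Minimal blow-up threshold. Suppose (G.29) fails. Define M∗ … Pick a sequence u^n with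
sup_{t<T_n}‖u^n(t)‖_{L³} ↓ M∗ and T_n < ∞»): IF a singularity occurs, THEN the minimal critical level
`M_c` is finite and realised as the limit of the finite critical levels of a sequence of singular
solutions — the input under which App. F.4 (Def F.7 (F.22) p.96 l.29–32 «‖u‖_{L^∞_t L³_x((−∞,T∗))} ≤ M <
∞») extracts the profile. KERNEL: `step_setup_iff_claimedTheorem` (§E).
[claim: Cox2025, status: disputed]
[cite: Cox2025, §4 p.19 l.15–31; (4.1); Prop 4.1 p.20 l.4–6; Thm G.5 proof (i) p.107 l.37–45; Def F.7 (F.22) p.96 l.29–32] -/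
def Step_setup : Prop :=
  (∃ (u₀ : E3 → E3) (T : ℝ) (u : ℝ → E3 → E3) (p : ℝ → E3 → ℝ), IsDatum u₀ ∧ IsSingular u₀ T u p) →
    MinimisingData

/-- **Step 2 — KL-1, Proposition 4.1 (Leray-aware APMS extraction) p.19 l.32 – p.20 l.16, at the grain of
its proof** (App. F.4: Def F.7 / Prop F.8 p.96 l.28 – p.98 l.70 «From Definition F.7, after subsequences
there exists an ancient suitable solution (u∞, p∞) on (−∞, 0] … and u∞ is APMS with modulus ϑ_APMS <
1»; Thm G.5 (ii) p.107 l.46–53 «rescale at peak scales λ_n and cores x_n as in Appendix F to obtain … an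
ancient suitable limit (u∞, p∞) with ‖u∞(0)‖_{L³} = lim ‖u^n(t_n)‖_{L³} = M∗ > 0»): from the minimising
data, «There exists a nontrivial ancient suitable solution (u∞, p∞) on (−∞, 0] × ℝ³ such that
sup_{t≤0}‖u∞(t)‖_{L³(ℝ³)} ≤ M_c < ∞, and, modulo translations … and critical scaling …, its orbit is
precompact in L³(ℝ³)». Not typed: «Leray-projection orthogonality is preserved …, profile remainders are
uniformly small in (z, r) with inter-profile pressure cross-terms bounded by c_osc C(κ) E_j (Lemma 1.9)»
(p.20 l.12–14; records). As typed its input is uninhabited (`not_minimisingData`) — `step_KL1_holds`.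
[claim: Cox2025, status: disputed] [cite: Cox2025, Prop 4.1 p.19 l.32 – p.20 l.16; Prop F.8 p.96 l.46 – p.98 l.70; Thm G.5 (ii) p.107 l.46–53] -/
def Step_KL1 : Prop :=
  MinimisingData →
    ∃ (U : ℝ → E3 → E3) (P : ℝ → E3 → ℝ),
      IsAPMSProfile U P ∧ IsNontrivial U ∧ L3supAncient U ≤ critLevel

/-- **KL-1 AS PRINTED, bare** (Prop 4.1 p.20 l.1–12, no hypothesis, with «≤ M_c < ∞»). Recorded face; the
chain consumes `Step_KL1`. [claim: Cox2025, status: disputed] [cite: Cox2025, Prop 4.1 p.20 l.1–12] -/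
def Step_KL1_bare : Prop :=
  ∃ (U : ℝ → E3 → E3) (P : ℝ → E3 → ℝ),
    IsAPMSProfile U P ∧ IsNontrivial U ∧ L3supAncient U ≤ critLevel ∧ critLevel < ⊤

/-- **KL-1 with the §4 hypothesis** (p.19 l.15–18 «assume that a smooth solution develops a singularity at
a finite time T∗ > 0. After rescaling … we isolate a minimal ancient profile precompact modulo symmetries
(KL-1)» + Prop 4.1 p.20 l.1–12): a singularity ⇒ a nontrivial ancient APMS profile below the FINITE
minimal threshold. Recorded face (= `Step_setup` followed by `Step_KL1`); KERNEL:
`step_KL1_hyp_iff_claimedTheorem`. [claim: Cox2025, status: disputed]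
[cite: Cox2025, §4 p.19 l.15–18; Prop 4.1 p.20 l.1–12] -/
def Step_KL1_hyp : Prop :=
  (∃ (u₀ : E3 → E3) (T : ℝ) (u : ℝ → E3 → E3) (p : ℝ → E3 → ℝ), IsDatum u₀ ∧ IsSingular u₀ T u p) →
    Step_KL1_bare

/-- **Step 3 — KL-2, Proposition 4.2 (pressure corrector and symmetrized flux) p.20 l.17–49, at statement
grain**: «For any suitable (u, p) on a parabolic cylinder Q, p = p_loc + p_far = Π_CZ[u ⊗ u] + Π_far[u ⊗
u], with ‖p_loc‖_{L^{3/2}(Q)} ≲ ‖u‖²_{L³(Q)}, and p_far represented by a dyadic annular CZ series …» —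
typed: a universal constant `C` such that on every parabolic cylinder `Q_r(z)`, `r > 0`, on which `(u,p)`
is suitable, `p = p_loc + p_far` a.e. on `Q_r(z)` with `∫∫_Q |p_loc|^{3/2} ≤ C^{3/2} (∫∫_Q |u|³)` (i.e.
`‖p_loc‖_{3/2} ≤ C ‖u‖²₃`) and `p_far(t, ·)` harmonic on `B_r(x)` for a.e. `t`. RECORDED, not typed: the
tail budget (4.2) «Σ_m τ_m ≤ τ0» and the harmonic-corrector bound (4.3) over the undisplayed `τ_m`, `h_Q`,
`W^{−1/3,3/2}(∂A)`. [claim: Cox2025, status: disputed] [cite: Cox2025, Prop 4.2 p.20 l.17–49] -/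
def Step_KL2 : Prop :=
  ∃ C : ℝ, 0 < C ∧
    ∀ (Q : TopologicalSpace.Opens (ℝ × E3)) (u : ℝ → E3 → E3) (p : ℝ → E3 → ℝ),
      IsSuitableWeakSolutionOn Q 1 0 u p →
      ∀ (r : ℝ) (z : ℝ × E3), 0 < r → parabolicCylinder r z ⊆ (Q : Set (ℝ × E3)) →
        ∃ (ploc pfar : ℝ → E3 → ℝ),
          (∀ᵐ q : ℝ × E3 ∂(volume.restrict (parabolicCylinder r z)), p q.1 q.2 = ploc q.1 q.2 + pfar q.1 q.2) ∧
          (∫⁻ q in parabolicCylinder r z, ‖ploc q.1 q.2‖ₑ ^ (3 / 2 : ℝ)) ≤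
            ENNReal.ofReal (C ^ (3 / 2 : ℝ)) * ∫⁻ q in parabolicCylinder r z, ‖u q.1 q.2‖ₑ ^ (3 : ℕ) ∧
          ∀ᵐ t : ℝ, t ∈ Ioo (z.1 - r ^ 2) z.1 →
            ContDiffOn ℝ 2 (pfar t) (Metric.ball z.2 r) ∧ ∀ x ∈ Metric.ball z.2 r, Δ (pfar t) x = 0

/-- **The undisplayed gadgets of KL-3** (Prop 4.3 p.21 l.3–31: «Let Δ_j denote Littlewood–Paley blocks and
ω_{j,τ} the Carleman weight. Fix λ, τ0 by (1.2)»; (4.4) «A_j[u] (nonlinear absorbed) + P_j[u, p] (pressure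
absorbed)» — never defined in closed form): named DATA, not steps (RULINGS 11:21Z (1)).
[cite: Cox2025, Prop 4.3 p.21 l.3–31; (1.2) p.7] -/
structure CarlemanKit where
  /-- the Littlewood–Paley block `Δ_j` acting on a slice. -/
  block : ℤ → (E3 → E3) → (E3 → E3)
  /-- the Carleman weight `ω_{j,τ}(t, x)`. -/
  weight : ℤ → ℝ → ℝ → E3 → ℝ
  /-- «A_j[u] — nonlinear absorbed». -/
  absorbN : ℤ → (ℝ → E3 → E3) → ℝ≥0∞
  /-- «P_j[u, p] — pressure absorbed». -/
  absorbP : ℤ → (ℝ → E3 → E3) → (ℝ → E3 → ℝ) → ℝ≥0∞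
  /-- the implicit constant of «≲» in (4.4). -/
  C : ℝ≥0∞
  /-- the threshold `τ0` of (1.2). -/
  τ0 : ℝ

/-- **Step 4 — KL-3, Proposition 4.3 (frequency-localized Carleman absorption), display (4.4) p.21 l.4–21,
VERBATIM over the kit**: «for all τ ≥ τ0 2^{2j}, ‖ω_{j,τ} Δ_j u‖²_{L²_{t,x}} ≲ ‖ω_{j,τ} Δ_j(Δu)‖²_{L²_{t,x}}
+ A_j[u] + P_j[u, p]», for every ancient suitable pair (the use in KL-5 / Thm E.8 p.88). (4.5) = (1.4) is
part of the kit's provenance, recorded. [claim: Cox2025, status: disputed]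
[cite: Cox2025, Prop 4.3 (4.4) p.21 l.3–33] -/
def Step_KL3 (K : CarlemanKit) : Prop :=
  ∀ (U : ℝ → E3 → E3) (P : ℝ → E3 → ℝ), IsAncientSuitable U P →
    ∀ (j : ℤ) (τ : ℝ), K.τ0 * (2 : ℝ) ^ (2 * j) ≤ τ →
      (∫⁻ q in (Iio (0 : ℝ)) ×ˢ (univ : Set E3),
          ENNReal.ofReal (K.weight j τ q.1 q.2 ^ 2) * ‖K.block j (U q.1) q.2‖ₑ ^ 2) ≤
        K.C * ((∫⁻ q in (Iio (0 : ℝ)) ×ˢ (univ : Set E3),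
            ENNReal.ofReal (K.weight j τ q.1 q.2 ^ 2) * ‖K.block j (fun x => Δ (U q.1) x) q.2‖ₑ ^ 2) +
          K.absorbN j U + K.absorbP j U P)

/-- **Step 5 — KL-4, Proposition 4.4 (APMS ⇒ reverse Hölder gain) p.21 l.34–45**: «For ancient APMS profiles
with modulus ϑ_APMS < 1 (as in (4.1)), paired weighted/unweighted Caccioppoli inequalities and Gehring
self-improvement give u∞ ∈ L^{3+ε}_loc((−∞, 0] × ℝ³), for some ε > 0 depending only on ϑ_APMS and ledger
constants.» [claim: Cox2025, status: disputed] [cite: Cox2025, Prop 4.4 p.21 l.34–45] -/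
def Step_KL4 : Prop :=
  ∀ (U : ℝ → E3 → E3) (P : ℝ → E3 → ℝ), IsAPMSProfile U P →
    ∃ ε : ℝ, 0 < ε ∧ ∀ K : Set (ℝ × E3), IsCompact K → K ⊆ Iic (0 : ℝ) ×ˢ (univ : Set E3) →
      (∫⁻ q in K, ‖U q.1 q.2‖ₑ ^ (3 + ε)) < ⊤

/-- **KL-5, Theorem 4.5 (Liouville for ancient endpoint APMS), first sentence p.21 l.46–48** («Let (u∞,
p∞) be the ancient APMS profile from KL-1. Then u∞ ≡ 0») = Prop E.9 p.89 l.9–13 («Let (u∞, p∞) be an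
ancient suitable solution which is APMS with modulus ϑ_APMS < 1 and ‖u∞‖_{L^∞_t L³_x} < ∞. Then u∞ ≡
0»). [claim: Cox2025, status: disputed] [cite: Cox2025, Thm 4.5 p.21 l.46–48; Prop E.9 p.89 l.9–13] -/
def Step_KL5 : Prop :=
  ∀ (U : ℝ → E3 → E3) (P : ℝ → E3 → ℝ), IsAPMSProfile U P → ∀ t : ℝ, t ≤ 0 → U t =ᵐ[volume] 0

/-- **Step 6 — the printed derivation of KL-5** (Thm 4.5 second sentence p.21 l.48–49 «The
frequency-localized Carleman estimate (KL-3) and integrability gain (KL-4) yield backward uniqueness at the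
endpoint, eliminating nontrivial ancient solutions with APMS compactness»; «Proof: App. E; cf. [11]»;
Prop E.9's proof p.89 l.14–16 via Thm E.8 (backward uniqueness) — which assumes `u(·, 0) ≡ 0`, a
hypothesis the two-line proof does not supply («Since u∞(·, 0) is arbitrary»); recorded): KL-2 ∧ KL-3 ∧
KL-4 ⇒ KL-5. [claim: Cox2025, status: disputed] [cite: Cox2025, Thm 4.5 p.21 l.48–50; Prop E.9 p.89 l.9–16; Thm E.8 p.88 l.46–50] -/
def Step_KL5_of (K : CarlemanKit) : Prop := Step_KL2 → Step_KL3 K → Step_KL4 → Step_KL5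

/-- **Step 7 — KL-6, Proposition 4.6 (Type I alternative), first sentence p.22 l.3–9** (= Thm 1.11 p.8
l.50–58; Props 5.6 p.26, 6.4 p.31, 8.2 p.40, 9.3 p.43): «There exist universal ε⋆ > 0, θ ∈ (0, 1), ρ ∈ (0,
1) … such that for every cylinder Q_{r0}(z0), either E3(z0, r0) ≤ ε⋆, or E3(z0, θr0) ≤ ρ E3(z0, r0)» —
for every suitable solution on a region containing the cylinder. No display defining `E3` was found in
the text layer (pp. 1–124); typed as the CKN scale-invariant cubic quantity `cknC r z u = r⁻² ∫∫_{Q_r(z)}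
|u|³` (recorded; the nearest DEFINED object in print is Prop B.11 (B.35) p.62 l.43–60, a dichotomy on the
raw cylinder masses `(∬_{Q(θr)}|u|³)^{1/3} ≤ ρ (∬_{Q(r)}|u|³)^{1/3}` — typed as the second face
`Step_KL6_mass`, §F). A face over a RECORDED typing choice: head-eligible only if a kernel object survives
every choice (REF-3 g7 (S3)). The «safe picks θ = 2⁻², ρ = max{C1θ³ + C2τ0^{3/2}, ϑ_APMS} < 1» are
examples, not typed.
[claim: Cox2025, status: disputed] [cite: Cox2025, Prop 4.6 p.22 l.3–9; Thm 1.11 p.8 l.50–58; Prop B.11 (B.35) p.62 l.43–60] -/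
def Step_KL6 : Prop :=
  ∃ (εs θ ρ : ℝ), 0 < εs ∧ 0 < θ ∧ θ < 1 ∧ 0 < ρ ∧ ρ < 1 ∧
    ∀ (Q : TopologicalSpace.Opens (ℝ × E3)) (u : ℝ → E3 → E3) (p : ℝ → E3 → ℝ),
      IsSuitableWeakSolutionOn Q 1 0 u p →
      ∀ (r : ℝ) (z : ℝ × E3), 0 < r → parabolicCylinder r z ⊆ (Q : Set (ℝ × E3)) →
        cknC r z u ≤ ENNReal.ofReal εs ∨ cknC (θ * r) z u ≤ ENNReal.ofReal ρ * cknC r z u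

/-- **Step 8 — KL-6's closing sentence p.22 l.10–11** («Combined with KL-3 coercivity and the pressure-smart
LEI (KL-2), this contradicts minimality of M_c; hence no Type I blow-up can occur»): KL-2 ∧ KL-3 ∧ KL-6 ⇒
no singular solution from a datum of class (4) is of Type I (tree `IsTypeIBlowup`: `|u(t,x)| ≤ C/√(T−t)`
near `T`). «Proof: Secs. 5, 7, 8.» [claim: Cox2025, status: disputed] [cite: Cox2025, Prop 4.6 p.22 l.10–13] -/
def Step_KL6_closes (K : CarlemanKit) : Prop :=
  Step_KL2 → Step_KL3 K → Step_KL6 →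
    ∀ (u₀ : E3 → E3) (T : ℝ) (u : ℝ → E3 → E3) (p : ℝ → E3 → ℝ),
      IsDatum u₀ → IsSingular u₀ T u p → ¬ IsTypeIBlowup u T

/-- **Step 9 — KL-7, Corollary 4.7 p.22 l.14–17** («If blow-up were Type II, the KL-4 reverse Hölder gain
feeds into KL-3, yielding the same contradiction as in KL-6. Thus no blow-up of any type occurs»): KL-3 ∧
KL-4 ⇒ (no Type-I singular solution ⇒ no singular solution at all). «Proof: Secs. 7, 8.»
[claim: Cox2025, status: disputed] [cite: Cox2025, Cor 4.7 p.22 l.14–19] -/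
def Step_KL7_closes (K : CarlemanKit) : Prop :=
  Step_KL3 K → Step_KL4 →
    (∀ (u₀ : E3 → E3) (T : ℝ) (u : ℝ → E3 → E3) (p : ℝ → E3 → ℝ),
      IsDatum u₀ → IsSingular u₀ T u p → ¬ IsTypeIBlowup u T) → NoSingular

/-- **The undisplayed shell/slab functionals of Theorem 7.2** (p.34 l.50–53 «the tail T_J := Σ_{j≥J} E_j³
across the slab. Let J∗ denote the peak dyadic index on S_R(x0, t0)» — `E_j` a dyadic shell quantity of
§6–§7 never displayed (Table 1 row C_env «E_{j+1} ≤ C_env E_j» is the only hint; page render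
`sources/Cox2025/renders-lit3/p034.png`, lit-3 g9); (7.8) «B_J(R) is a scale-invariant boundary budget»):
named DATA attached to a solution and a slab centre/radius. [cite: Cox2025, §7 p.34 l.50 – p.35 l.14] -/
structure ShellKit where
  /-- `T_J(t)` for the solution `u` on the slab of centre `z0`, radius `R`: the dyadic tail. -/
  tail : (ℝ → E3 → E3) → ℝ × E3 → ℝ → ℕ → ℝ → ℝ≥0∞
  /-- `B_J(R)`: the boundary budget. -/
  budget : (ℝ → E3 → E3) → ℝ × E3 → ℝ → ℕ → ℝ≥0∞
  /-- `J∗`: the peak dyadic index on the slab. -/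
  peak : (ℝ → E3 → E3) → ℝ × E3 → ℝ → ℕ
  /-- the slab parameter `θ` and the constant `C` of (7.8). -/
  θ : ℝ
  C : ℝ≥0∞

/-- **Theorem 7.2 (Tail contraction) (7.8) p.35 l.9–14, over the kit**: «There exist universal m0 ∈ ℕ and σ
∈ (0, 1) … such that for every caloric slab S_R(z0) and J ≥ J∗ + m0, T_J(t0) ≤ σ T_J(t0 − θR²) + C B_J(R)»,
for every suitable solution on a region containing the slab. Its proof sentence is labelled «Heuristic
mechanism … high×low terms are absorbed by Bernstein and critical L³ conservation» (p.35 l.15–26; the `L³`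
norm is not conserved by the flow — recorded); «Complete proof in App. D» — on App. D's pages 74–81 neither
«(7.8)» nor «T_J» occurs except the self-reference p.80 l.51; App. D's tail item is Prop D.5 (D.14)–(D.16)
p.77, a different display (lit-3 g9, `LOCATORS-APPS.md` §1b-B; recorded). NOT a binder of the compositions
(consumed in print inside App. F (F.32) and the KL-6 proofs). [claim: Cox2025, status: disputed]
[cite: Cox2025, Thm 7.2 (7.8) p.35 l.9–26] -/
def Step_Thm72 (S : ShellKit) : Prop :=
  ∃ (m₀ : ℕ) (σ : ℝ), 0 < σ ∧ σ < 1 ∧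
    ∀ (Q : TopologicalSpace.Opens (ℝ × E3)) (u : ℝ → E3 → E3) (p : ℝ → E3 → ℝ),
      IsSuitableWeakSolutionOn Q 1 0 u p →
      ∀ (z₀ : ℝ × E3) (R : ℝ), 0 < R → parabolicCylinder R z₀ ⊆ (Q : Set (ℝ × E3)) →
        ∀ J : ℕ, S.peak u z₀ R + m₀ ≤ J →
          S.tail u z₀ R J z₀.1 ≤ ENNReal.ofReal σ * S.tail u z₀ R J (z₀.1 - S.θ * R ^ 2) + S.C * S.budget u z₀ R J

/-- **Theorem G.5 (Global L³ a priori bound) (G.29) p.107 l.23–36** («For any divergence-free u0 ∈ L³(ℝ³),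
the suitable solution satisfies sup_{t≥0}‖u(t)‖_{L³(ℝ³)} ≤ M(‖u0‖_{L³}). Orientation: This precludes
finite-time blow-up»), INSTANTIATED on the finite-energy classical solutions from data of class (4) on
half-open slabs (the print's «the suitable solution» from `L³` data is wider — `-- TODO(general form)`):
a level function `M`, finite on finite levels, bounds the critical level of every such solution by
`M(‖u₀‖_{L³})`. Its printed proof (i)–(iv) p.107 l.37–61 is the §4 chain; step (i) = `Step_setup`.
[claim: Cox2025, status: disputed] [cite: Cox2025, Thm G.5 (G.29) p.107 l.23–61] -/
def Step_G5 : Prop :=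
  ∃ M : ℝ≥0∞ → ℝ≥0∞, (∀ a : ℝ≥0∞, a < ⊤ → M a < ⊤) ∧
    ∀ (u₀ : E3 → E3) (T : ℝ) (u : ℝ → E3 → E3) (p : ℝ → E3 → ℝ), IsDatum u₀ →
      IsClassicalNSSolutionOn (Ico 0 T) 1 0 u p → u 0 = u₀ → FiniteEnergyOn (Ico 0 T) u →
        L3sup T u ≤ M (eLpNorm u₀ 3 volume)

/-! ## D. The compositions (PROVED — pure logic; every binder consumed) -/

/-- **COMPOSITION, route R1 (Thm 9.6 «Mechanism» p.44 l.33–35; Table 2 «Summary and handoff» p.9 l.46–47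
«verify that no finite-time blow-up or nontrivial ancient profile can exist, thereby proving Theorem
1.1»)**: a singular solution ⇒ (set-up) minimising data ⇒ (KL-1) a nontrivial ancient APMS profile ⇒
(KL-5, from KL-2/3/4) the profile vanishes — contradiction; hence no datum carries a singular solution
and, by the local alternative, every datum is Clay-solvable. Binders in dependency order: `hloc`, `hset`,
`h1`, `h2`, `h3`, `h4`, `h5`. [cite: Cox2025, Thm 9.6 p.44 l.33–37; p.9 l.46–47; §4 p.19 l.15–19] -/
theorem claim_of_steps (K : CarlemanKit) (hloc : Step_local) (hset : Step_setup) (h1 : Step_KL1)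
    (h2 : Step_KL2) (h3 : Step_KL3 K) (h4 : Step_KL4) (h5 : Step_KL5_of K) : ClaimedTheorem := by
  intro u₀ hd
  rcases hloc u₀ hd with hsol | ⟨T, u, p, hs⟩
  · exact hsol
  · exfalso
    obtain ⟨U, P, hprof, hnt, -⟩ := h1 (hset ⟨u₀, T, u, p, hd, hs⟩)
    exact hnt (h5 h2 h3 h4 U P hprof)

/-- **COMPOSITION, route R2 («KL–6/7 close the Type I/II channels», Thm 9.6 p.44 l.35–36; Cor 4.7 p.22
l.16–17 «Thus no blow-up of any type occurs»)**: KL-2 ∧ KL-3 ∧ KL-6 exclude Type I singular solutions,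
KL-3 ∧ KL-4 turn that into «no singular solution», and the local alternative concludes.
[cite: Cox2025, Prop 4.6 p.22 l.10–11; Cor 4.7 p.22 l.14–17; Thm 9.6 p.44 l.35–36] -/
theorem claim_of_steps_typeI_II (K : CarlemanKit) (hloc : Step_local) (h2 : Step_KL2) (h3 : Step_KL3 K)
    (h4 : Step_KL4) (h6 : Step_KL6) (h6c : Step_KL6_closes K) (h7c : Step_KL7_closes K) :
    ClaimedTheorem := by
  intro u₀ hd
  rcases hloc u₀ hd with hsol | ⟨T, u, p, hs⟩
  · exact hsol
  · exact absurd ⟨u₀, T, u, p, hd, hs⟩ (h7c h3 h4 (h6c h2 h3 h6))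

/-! ## E. Kernel-checked relations (tree theorems + pure logic; nothing of the paper is asserted) -/

/-- **Step 0 is a theorem of the tree** (the blow-up alternative `clayR3_solvable_or_supBlowup` at ν = 1:
a non-solvable datum of class (4) carries a maximal finite-energy classical solution on some `[0,T∗)`,
`T∗ > 0`, with no finite-energy classical solution from the datum on any closed slab `[0,T]`, `T ≥ T∗`).
[cite: Cox2025, p.7 l.1–6] [cite: Leray1934, §33] [cite: Tao2011, Cor. 11.1, Cor. 11.4] -/
theorem step_local_holds : Step_local := by
  intro u₀ hd
  rcases clayR3_solvable_or_supBlowup one_pos hd.1 hd.2.1 hd.2.2 with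
    hsol | ⟨Ts, hTs, u, p, hcl, hu0, hE, -, hmax⟩
  · exact Or.inl hsol
  · exact Or.inr ⟨Ts, u, p, hTs, hcl, hu0, hE, fun w q hw hw0 hEw => hmax Ts le_rfl w q hw hw0 hEw⟩

/-- **A singular solution from a datum of class (4) leaves every `L³` ball: `sup_{t<T∗}‖u(t)‖_{L³} = ∞`**
(the Escauriaza–Seregin–Šverák continuation theorem of the tree,
`IsClassicalNSSolutionOn.exists_Icc_of_eLpNorm_three_bounded`: with bounded `L³` norms the finite-energy
classical solution on `[0,T)` continues to the closed slab `[0,T]`, against the singularity).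
[cite: EscauriazaSereginSverak2003, Thm. 1.4] [cite: Seregin2012CMP, Thm. 1.1] [cite: Cox2025, p.5 l.19–21 (the text cites ESS [10, 11])] -/
theorem L3sup_eq_top_of_singular {u₀ : E3 → E3} {T : ℝ} {u : ℝ → E3 → E3} {p : ℝ → E3 → ℝ}
    (hd : IsDatum u₀) (hs : IsSingular u₀ T u p) : L3sup T u = ⊤ := by
  obtain ⟨hT, hcl, hu0, hE, hmax⟩ := hs
  by_contra hne
  have hL3 : (⨆ t ∈ Ico 0 T, eLpNorm (u t) 3 volume) < ⊤ := lt_top_iff_ne_top.2 hne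
  have hdec0 : HasRapidSpatialDecay (u 0) := by
    rw [hu0]
    exact hd.2.2
  obtain ⟨u', p', hcl', heq, hE'⟩ := hcl.exists_Icc_of_eLpNorm_three_bounded one_pos hT hdec0 hE hL3
  exact hmax u' p' hcl' (by rw [heq 0 ⟨le_rfl, hT⟩, hu0]) hE'

/-- **The minimal blow-up threshold is `⊤`** (every level entering the infimum is `⊤`).
[cite: Cox2025, (G.30) p.107 l.38–40; (4.1) p.19] [cite: EscauriazaSereginSverak2003, Thm. 1.4] -/
theorem critLevel_eq_top : critLevel = ⊤ := by
  refine iInf_eq_top.2 fun u₀ => iInf_eq_top.2 fun T => iInf_eq_top.2 fun u => iInf_eq_top.2 fun p =>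
    iInf_eq_top.2 fun h => ?_
  exact L3sup_eq_top_of_singular h.1 h.2

/-- **The minimising data of the set-up do not exist** (`M_c = ⊤`). [cite: Cox2025, Thm G.5 proof (i) p.107 l.37–45]
[cite: EscauriazaSereginSverak2003, Thm. 1.4] -/
theorem not_minimisingData : ¬ MinimisingData := fun h => by
  have h1 := h.1
  rw [critLevel_eq_top] at h1
  exact lt_irrefl _ h1

/-- **KL-1 at the grain of its proof holds VACUOUSLY** (its typed input is uninhabited). Recorded — this
says nothing about App. F. [cite: Cox2025, Prop 4.1 p.19 l.32 – p.20 l.16] -/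
theorem step_KL1_holds : Step_KL1 := fun h => absurd h not_minimisingData

/-- A Clay-solvable datum of class (4) carries no singular solution (the Clay solution bounds the `L³`
norms of every finite-energy classical solution from the same datum on its horizon —
`biSup_eLpNorm_three_lt_top_of_clayR3_solvable` — against `L3sup_eq_top_of_singular`).
[cite: FeffermanClay2006, (A) p.2] [cite: Tao2011, Cor. 11.4] -/
theorem not_isSingular_of_solvable {u₀ : E3 → E3} {T : ℝ} {u : ℝ → E3 → E3} {p : ℝ → E3 → ℝ}
    (hd : IsDatum u₀) (hsol : clayR3.Solvable 1 0 u₀) : ¬ IsSingular u₀ T u p := fun hs =>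
  (biSup_eLpNorm_three_lt_top_of_clayR3_solvable one_pos hd.1 hd.2.2 hs.2.1 hs.2.2.1 hs.2.2.2.1
    hsol).ne (L3sup_eq_top_of_singular hd hs)

/-- **The claimed theorem ⇔ no datum of class (4) carries a singular solution** (local alternative one way,
the previous lemma the other). [cite: Cox2025, Thm 9.6 p.44 l.33–35] [cite: Leray1934, §33] -/
theorem claimedTheorem_iff_noSingular : ClaimedTheorem ↔ NoSingular := by
  constructor
  · rintro h ⟨u₀, T, u, p, hd, hs⟩
    exact not_isSingular_of_solvable hd (h u₀ hd) hs
  · intro h u₀ hd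
    rcases step_local_holds u₀ hd with hsol | ⟨T, u, p, hs⟩
    · exact hsol
    · exact absurd ⟨u₀, T, u, p, hd, hs⟩ h

/-- **ROUTE 5b face — THE SET-UP STEP IS EQUIVALENT TO THE CLAIMED THEOREM.** Since `M_c = ⊤`
(`critLevel_eq_top`), «a singularity ⇒ minimising data at a finite level» holds exactly when no
singularity occurs, i.e. exactly when the claimed theorem holds. [cite: Cox2025, §4 p.19 l.15–31; Thm G.5 proof (i) p.107 l.37–45]
[cite: EscauriazaSereginSverak2003, Thm. 1.4] -/
theorem step_setup_iff_claimedTheorem : Step_setup ↔ ClaimedTheorem := by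
  rw [claimedTheorem_iff_noSingular]
  constructor
  · intro h hex
    exact not_minimisingData (h hex)
  · intro h hex
    exact absurd hex h

/-- The bare printed KL-1 forces `M_c < ∞`, which fails (`critLevel_eq_top`): the hypothesis-carrying face
is likewise equivalent to the claimed theorem. [cite: Cox2025, §4 p.19 l.15–18; Prop 4.1 p.20 l.1–12]
[cite: EscauriazaSereginSverak2003, Thm. 1.4] -/
theorem step_KL1_hyp_iff_claimedTheorem : Step_KL1_hyp ↔ ClaimedTheorem := by
  rw [claimedTheorem_iff_noSingular]
  constructor
  · intro h hex
    obtain ⟨-, -, -, -, -, hlt⟩ := h hex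
    rw [critLevel_eq_top] at hlt
    exact lt_irrefl _ hlt
  · intro h hex
    exact absurd hex h

/-- **Theorem G.5 (as instantiated) gives the claimed theorem** — the tree's «(A) at ν = 1 ⇔ the a priori
`L³` bound» (`clayR3_regularityAt_iff_aprioriL3Bound`): a finite-valued level function bounds the critical
level of every finite-energy classical solution from a datum of class (4), so none of them blows up in
`L³`. [cite: Cox2025, Thm G.5 (G.29) p.107 l.23–36 «This precludes finite-time blow-up»]
[cite: EscauriazaSereginSverak2003, Thm. 1.4] [cite: FeffermanClay2006, (A) p.2] -/
theorem claim_of_G5 (hG : Step_G5) : ClaimedTheorem := by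
  obtain ⟨M, hM, hb⟩ := hG
  have hreg : clayR3.RegularityAt 1 := by
    refine (clayR3_regularityAt_iff_aprioriL3Bound one_pos).2 ?_
    intro u₀ hu₀ hdiv hdec T u p hcl hu0 hA
    have hdat : IsDatum u₀ := ⟨hu₀, hdiv, hdec⟩
    have hfin : eLpNorm u₀ 3 volume < ⊤ := by
      have h0 : ∫⁻ y, ‖u₀ y‖ₑ ^ 2 < ⊤ := by
        refine lt_of_le_of_lt (le_of_eq (lintegral_congr fun y => ?_))
          (hdec.lintegral_enorm_iteratedFDeriv_sq_lt_top (μ := volume) 0)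
        rw [← ofReal_norm, ← ofReal_norm, norm_iteratedFDeriv_zero]
      obtain ⟨C, hC⟩ := hdec 0 0
      have hbd : ∀ y, ‖u₀ y‖ ≤ C := fun y => by simpa [norm_iteratedFDeriv_zero] using hC y
      have h2 : MemLp u₀ 2 volume :=
        ⟨hu₀.continuous.aestronglyMeasurable, eLpNorm_two_lt_top_of_lintegral_enorm_sq_lt_top h0⟩
      have hinf : MemLp u₀ ⊤ volume :=
        memLp_top_of_bound hu₀.continuous.aestronglyMeasurable C (Eventually.of_forall hbd)
      exact (memLp_of_memLp_of_memLp_top (p := 2) (q := 3) (by norm_num) (by norm_num) h2 hinf).2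
    exact lt_of_le_of_lt (hb u₀ T u p hdat hcl hu0 hA) (hM _ hfin)
  exact fun u₀ hd => hreg u₀ hd.1 hd.2.1 hd.2.2

/-- **CLAY LINK (PROVED, both ways)**: the claimed theorem IS Clay (A) — data (4) exactly, ν = 1 ⇔ every ν >
0 by the tree's scaling `clayR3_regularityAt_iff`. No «wrong problem» axis.
[cite: FeffermanClay2006, (A) with (4) (6) (7) p.2] [cite: Cox2025, Thm 9.6 p.44 l.26–29; p.5 l.2–5] -/
theorem claimedTheorem_iff_clayA : ClaimedTheorem ↔ clayR3.Regularity := by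
  rw [← clayR3_regularityAt_iff one_pos]
  constructor
  · intro h u₀ hu₀ hdiv hdec
    exact h u₀ ⟨hu₀, hdiv, hdec⟩
  · intro h u₀ hd
    exact h u₀ hd.1 hd.2.1 hd.2.2

/-- Clay (A) from the claimed theorem. [cite: FeffermanClay2006, (A) p.2] -/
theorem clayA_of_claimed (h : ClaimedTheorem) : clayR3.Regularity := claimedTheorem_iff_clayA.1 h

/-- Theorem 1.1's face implies Theorem 9.6's (drop the extra clauses). [cite: Cox2025, Thm 1.1 p.6; Thm 9.6 p.44] -/
theorem claimedTheorem_of_claimedTheorem11 (h : ClaimedTheorem11) : ClaimedTheorem := by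
  intro u₀ hd
  obtain ⟨u, p, hsu, hsp, hns, hE, -, -⟩ := h u₀ hd
  exact ⟨u, p, hsu, hsp, hns, hE⟩

/-- Clay (A) from the printed chain (route R1). [cite: Cox2025, Thm 9.6 p.44 l.33–37] [cite: FeffermanClay2006, (A) p.2] -/
theorem clayA_of_steps (K : CarlemanKit) (hloc : Step_local) (hset : Step_setup) (h1 : Step_KL1)
    (h2 : Step_KL2) (h3 : Step_KL3 K) (h4 : Step_KL4) (h5 : Step_KL5_of K) : clayR3.Regularity :=
  clayA_of_claimed (claim_of_steps K hloc hset h1 h2 h3 h4 h5)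

/-! ## F. Rev-2 faces (append-only records; not binders of the compositions) -/

/-- The raw cylinder `L³` mass `∬_{Q_r(z)} |u|³` (Prop B.11 (B.35) p.62 l.43–60 grain).
[cite: Cox2025, Prop B.11 (B.35) p.62 l.43–60] -/
def cylL3 (r : ℝ) (z : ℝ × E3) (u : ℝ → E3 → E3) : ℝ≥0∞ :=
  ∫⁻ q in parabolicCylinder r z, ‖u q.1 q.2‖ₑ ^ (3 : ℕ)

/-- **KL-6 / Thm 1.11, second typing choice for the undefined `E3`**: `E3(z, r) := (∬_{Q_r(z)} |u|³)^{1/3}`,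
the raw (un-normalised) cylinder mass of Prop B.11 (B.35) p.62 («(∬_{Q(t0,x0;θr)}|u|³)^{1/3} ≤ ρ
(∬_{Q(t0,x0;r)}|u|³)^{1/3} or …»), in the universal dichotomy of Prop 4.6 p.22 l.3–9: «either E3(z0, r0) ≤
ε⋆, or E3(z0, θr0) ≤ ρ E3(z0, r0)». Recorded face (REF-3 g7 (S3)); `Step_KL6` is the CKN-normalised one.
[claim: Cox2025, status: disputed] [cite: Cox2025, Prop 4.6 p.22 l.3–9; Thm 1.11 p.8 l.50–58; Prop B.11 (B.35) p.62 l.43–60] -/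
def Step_KL6_mass : Prop :=
  ∃ (εs θ ρ : ℝ), 0 < εs ∧ 0 < θ ∧ θ < 1 ∧ 0 < ρ ∧ ρ < 1 ∧
    ∀ (Q : TopologicalSpace.Opens (ℝ × E3)) (u : ℝ → E3 → E3) (p : ℝ → E3 → ℝ),
      IsSuitableWeakSolutionOn Q 1 0 u p →
      ∀ (r : ℝ) (z : ℝ × E3), 0 < r → parabolicCylinder r z ⊆ (Q : Set (ℝ × E3)) →
        (cylL3 r z u) ^ (1 / 3 : ℝ) ≤ ENNReal.ofReal εs ∨
          (cylL3 (θ * r) z u) ^ (1 / 3 : ℝ) ≤ ENNReal.ofReal ρ * (cylL3 r z u) ^ (1 / 3 : ℝ)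

/-- The two `E3` readings differ by the scale factor only: `cknC r z u = (r²)⁻¹ · cylL3 r z u`.
[cite: CaffarelliKohnNirenberg1982, §2] -/
theorem cknC_eq_cylL3 (r : ℝ) (z : ℝ × E3) (u : ℝ → E3 → E3) :
    cknC r z u = (ENNReal.ofReal r ^ 2)⁻¹ * cylL3 r z u := rfl

/-- **Def 2.3 (Compactness modulus) (2.7) p.11 l.49–55, over posited gadgets** («An APMS solution u has a
compactness modulus ϑ_APMS ∈ (0, 1) if for every η ∈ (0, 1) there exist R(η), J(η) > 0 such that for all t ∈
I, ‖u(t)‖_{L³(|x−x(t)|>R(η)λ(t))} + Σ_{|j−j(t)|>J(η)} ‖Δ_j u(t)‖_{L³} ≤ ϑ_APMS η»): the Littlewood–Paley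
blocks `Δ_j`, the peak index `j(t)` and the modulation `(λ(t), x(t))` are named DATA. REF-3 g7 (S4)
records that the `η`-quantifier absorbs `ϑ` (a precompact orbit admits every `ϑ ∈ (0,1)` as printed).
[cite: Cox2025, Def 2.3 (2.7) p.11 l.49–55; (2.5)–(2.6) p.11 l.22–43] -/
def HasModulus (U : ℝ → E3 → E3) (block : ℤ → (E3 → E3) → (E3 → E3)) (jpeak : ℝ → ℤ) (lam : ℝ → ℝ)
    (xc : ℝ → E3) (ϑ : ℝ) : Prop :=
  0 < ϑ ∧ ϑ < 1 ∧
    ∀ η : ℝ, 0 < η → η < 1 → ∃ (R : ℝ) (J : ℕ), 0 < R ∧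
      ∀ t : ℝ, t ≤ 0 →
        eLpNorm ((Metric.closedBall (xc t) (R * lam t))ᶜ.indicator (U t)) 3 volume +
            (∑' j : ℤ, if (J : ℤ) < |j - jpeak t| then eLpNorm (block j (U t)) 3 volume else 0) ≤
          ENNReal.ofReal (ϑ * η)

/-- **The ancient APMS profiles WITH the printed modulus clause «ϑ_APMS < 1»** (Prop 4.4 p.21 l.36, Prop E.9
p.89 l.9–11; 2-READ typist-3 g7 (5a)): `IsAPMSProfile` plus a modulus for some posited block family / peak
index / modulation. Recorded face — the compositions use `IsAPMSProfile`.
[claim: Cox2025, status: disputed] [cite: Cox2025, Def 2.3 (2.7) p.11 l.49–55; Prop 4.4 p.21 l.36; Prop E.9 p.89 l.9–11] -/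
def IsAPMSProfileMod (U : ℝ → E3 → E3) (P : ℝ → E3 → ℝ) : Prop :=
  IsAPMSProfile U P ∧
    ∃ (block : ℤ → (E3 → E3) → (E3 → E3)) (jpeak : ℝ → ℤ) (lam : ℝ → ℝ) (xc : ℝ → E3) (ϑ : ℝ),
      HasModulus U block jpeak lam xc ϑ

/-- **KL-5 on the modulus-carrying class** (Thm 4.5 p.21 l.46–48 / Prop E.9 p.89 l.9–13 with «modulus ϑ_APMS <
1» explicit). Implied by `Step_KL5` (`step_KL5_mod_of`). [claim: Cox2025, status: disputed]
[cite: Cox2025, Thm 4.5 p.21 l.46–48; Prop E.9 p.89 l.9–13] -/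
def Step_KL5_mod : Prop :=
  ∀ (U : ℝ → E3 → E3) (P : ℝ → E3 → ℝ), IsAPMSProfileMod U P → ∀ t : ℝ, t ≤ 0 → U t =ᵐ[volume] 0

/-- **KL-4 on the modulus-carrying class** (Prop 4.4 p.21 l.34–45 with «modulus ϑ_APMS < 1 (as in (4.1))»
explicit). Implied by `Step_KL4` (`step_KL4_mod_of`). [claim: Cox2025, status: disputed]
[cite: Cox2025, Prop 4.4 p.21 l.34–45] -/
def Step_KL4_mod : Prop :=
  ∀ (U : ℝ → E3 → E3) (P : ℝ → E3 → ℝ), IsAPMSProfileMod U P →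
    ∃ ε : ℝ, 0 < ε ∧ ∀ K : Set (ℝ × E3), IsCompact K → K ⊆ Iic (0 : ℝ) ×ˢ (univ : Set E3) →
      (∫⁻ q in K, ‖U q.1 q.2‖ₑ ^ (3 + ε)) < ⊤

/-- The wider-class KL-5 implies the modulus-class KL-5 (pure logic). [cite: Cox2025, Thm 4.5 p.21 l.46–48] -/
theorem step_KL5_mod_of (h : Step_KL5) : Step_KL5_mod := fun U P hU t ht => h U P hU.1 t ht

/-- The wider-class KL-4 implies the modulus-class KL-4 (pure logic). [cite: Cox2025, Prop 4.4 p.21 l.34–45] -/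
theorem step_KL4_mod_of (h : Step_KL4) : Step_KL4_mod := fun U P hU => h U P hU.1

end Literature.Claims.NS.Cox2025

end

-- WHAT THIS IS NOT: not a claim about NS regularity or blow-up; not a claim about any author beyond the typed locator.
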